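import Summits.QuantumFields.GaugeBoot.StrongCouplingDoublePlaquette
import HarnessLib

/-!
# Strong coupling from the loop equation, IV: the `SU(N)` pieces — deformed words, double traces, the doubly-wound plaquette (gauge-boot, ADDENDUM 22 part E, file 1/2)

HONEST FRAMING (cell `pub-gaugeboot`, page 1 of every file): the venture produces certified bounds
on lattice expectations at stated coupling, gauge group, dimension and torus size; NOT a mass gap,
NOT a continuum limit, NOT a string tension; NOT Yang–Mills-summit-bearing (barriers
`FixedCouplingUltralocality`, `PerturbativeInvisibility`).  Explicit STRONG-COUPLING estimates on the torus `(ℤ/L)^d`,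
`L ≥ 2`, every real `β`; informative only for small `|β|`; no number of CERTIFIED.md is touched.

## Content (`SU(N)`, fundamental representation, weight `s = 1`, tree coupling `β = β_std/N`)

The `O(β)` inputs of the second loop-equation step for the `SU(N)` plaquette (`StrongCouplingPlaquetteSUN`): the deformed
words `|E[tr hol(P̃₀·q)]| ≤ 4(d−1)N²|β|/(N²−1)` and THE DOUBLE TRACES `|E[tr U_P · tr hol q]| ≤ 4(d−1)N³|β|/(N²−1)` for
every closed `q` avoiding `(x + e_μ, ν₀)` (two-word loop equation with the marked plaquette re-based at `x + e_μ`: no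
merge terms); `|E|tr U_P|² − 1| ≤ 4(d−1)N|β|`; for `N ≥ 3` the doubly-wound plaquette and the squared trace from the 2×2
system of `StrongCouplingDoublePlaquette` (`m = N − 2/N`, non-degenerate iff `N ≥ 3`); for `SU(2)` instead
`E[tr U_P²] = E[(tr U_P)²] − 2` (NOT small) and `|E[(tr U_P)²] − 1| ≤ 8(d−1)|β|`.

References: Yu. Makeenko, *Methods of contemporary gauge theory* (2002) Problem 12.7; V. Kazakov, Z. Zheng,
arXiv:2404.16925 §2.3.  Everything is `[folklore]`.
-/

noncomputable section

open MeasureTheory Filter Topology NormedSpace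
open scoped Matrix.Norms.Frobenius Matrix
open Literature.MathematicalPhysics.QuantumFieldTheory Literature.MathematicalPhysics.QuantumLattice
open Summit.QuantumFields.YangMills.Cruxes.CurvatureAmnesia.WardDefect.SchwingerDyson

namespace Summit.QuantumFields.GaugeBoot

namespace StrongCoupling

variable {d L N : ℕ} [NeZero L]

omit [NeZero L] in
/-- `‖β/2‖ = |β|/2` for the complex coefficient of the plaquette terms. [folklore] -/
theorem norm_half_ofReal (β : ℝ) : ‖(β / 2 : ℂ)‖ = |β| / 2 := by
  rw [show (β / 2 : ℂ) = ((β / 2 : ℝ) : ℂ) by push_cast; ring, Complex.norm_real, Real.norm_eq_abs, abs_div, abs_two]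

omit [NeZero L] in
/-- `0 ≤ d − 1` as soon as an axis exists. [folklore] -/
theorem sub_one_nonneg_of_axis (μ : Fin d) : (0 : ℝ) ≤ (d : ℝ) - 1 := by
  have : (1 : ℝ) ≤ d := by exact_mod_cast (Fin.pos μ)
  linarith

/-! ## Single traces of the deformed words and double traces with an avoiding spectator -/

section Avoiding

/-- **One step on a deformed plaquette word, `SU(N)`** (`N ≥ 2`): for `q` read from `x`, closed at `x` and avoiding
`(x + e_μ, ν₀)`, `‖E[tr hol_x(P̃₀ · q)]‖ ≤ 4(d−1)N²|β|/(N²−1)`. [folklore] -/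
theorem norm_integral_trace_plaqWord_append_suN_le (hN : 2 ≤ N) (hL : (1 : ZMod L) ≠ 0) (β : ℝ) (x : Site d L)
    {μ ν₀ : Fin d} (hμν₀ : μ ≠ ν₀) {q : Word d} (hq : Word.Avoids x q (x.shift μ, ν₀)) (hqx : Word.endpoint x q = x) :
    ‖∫ U, (fundamentalRep (Fin N) (wordHolonomy U x (plaqWord μ ν₀ true ++ q))).trace
        ∂(wilsonMeasure (d := d) (L := L) (fundamentalRep (Fin N)) β)‖ ≤
      4 * ((d : ℝ) - 1) * (N : ℝ) ^ 2 * |β| / ((N : ℝ) ^ 2 - 1) := by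
  simp_rw [trace_wordHolonomy_plaqWord_append _ x μ ν₀ q hqx]
  exact norm_integral_trace_suN_le (d := d) (L := L) hN β (x.shift μ) ν₀ _ (endpoint_rot x μ ν₀ q hqx)
    fun U => sum_splitTerm_rot (fundamentalRep (Fin N)) hL 1 x hμν₀ U hq hqx

omit [NeZero L] in
/-- The marked plaquette re-based at its second vertex: `tr hol_x(P̃₀) = tr hol_{x+e_μ}(+ν₀ −μ −ν₀ +μ)`, and
`+ν₀ −μ −ν₀ +μ = P̃_{μ,−}` of the edge `(x + e_μ, ν₀)`. [folklore] -/
theorem trace_wordHolonomy_plaqWord_rot {G : Type} [Group G] {ρ : G →* Matrix (Fin N) (Fin N) ℂ} (U : GaugeConfig d L G)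
    (x : Site d L) (μ ν₀ : Fin d) :
    (ρ (wordHolonomy U x (plaqWord μ ν₀ true))).trace = (ρ (wordHolonomy U (x.shift μ) (plaqWord ν₀ μ false))).trace := by
  have h := trace_wordHolonomy_plaqWord_append (ρ := ρ) U x μ ν₀ [] (by simp)
  rw [List.append_nil] at h
  rw [h]
  rfl

/-- ★ **The double traces are `O(β)`, `SU(N)`** (`N ≥ 2`): for `q` read from `x`, closed at `x` and avoiding `(x + e_μ, ν₀)`
(every plaquette word through `(x, μ)` other than `P̃₀`, and its reverse):
`‖E[tr U_{P₀} · tr hol_x q]‖ ≤ 4(d−1)N³|β|/(N²−1)` — the two-word loop equation of the re-based marked plaquette at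
`(x + e_μ, ν₀)` with spectator `q` has NO merge terms, one split term `(N − 1/N)·E[tr U_P · tr hol q]`, and plaquette
terms bounded by `4N·N`. [folklore] -/
theorem norm_integral_trace_mul_trace_suN_le (hN : 2 ≤ N) (hL : (1 : ZMod L) ≠ 0) (β : ℝ) (x : Site d L)
    {μ ν₀ : Fin d} (hμν₀ : μ ≠ ν₀) {q : Word d} (hq : Word.Avoids x q (x.shift μ, ν₀)) :
    ‖∫ U, (fundamentalRep (Fin N) (wordHolonomy U x (plaqWord μ ν₀ true))).trace *
        (fundamentalRep (Fin N) (wordHolonomy U x q)).trace ∂(wilsonMeasure (d := d) (L := L) (fundamentalRep (Fin N)) β)‖ ≤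
      4 * ((d : ℝ) - 1) * (N : ℝ) ^ 3 * |β| / ((N : ℝ) ^ 2 - 1) := by
  have hν₀μ : ν₀ ≠ μ := fun h => hμν₀ h.symm
  have hNpos : (0 : ℝ) < N := by
    have : (2 : ℝ) ≤ N := by exact_mod_cast hN
    linarith
  have hN21 : (0 : ℝ) < (N : ℝ) ^ 2 - 1 := by
    have : (2 : ℝ) ≤ N := by exact_mod_cast hN
    nlinarith
  -- the two-word loop equation at `(x + e_μ, ν₀)`, marked word `P̃_{μ,−}` there, spectator `q` from `x`
  have h := loopEquation₂_specialUnitaryGroup (d := d) (L := L) N β (x.shift μ) ν₀ (plaqWord ν₀ μ false)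
    (endpoint_plaqWord _ ν₀ μ false) x q
  have hi1 : ∀ k, Integrable (fun U : GaugeConfig d L (Matrix.specialUnitaryGroup (Fin N) ℂ) =>
      splitTerm (fundamentalRep (Fin N)) 1 (x.shift μ) ν₀ U (plaqWord ν₀ μ false) k *
        (fundamentalRep (Fin N) (wordHolonomy U x q)).trace) (wilsonMeasure (d := d) (L := L) (fundamentalRep (Fin N)) β) :=
    fun k => integrable_of_continuous (fundamentalLatticeRep N) β
      ((continuous_splitTerm (fundamentalLatticeRep N) 1 (x.shift μ) ν₀ _ k).mul
        (continuous_trace_wordHolonomy (fundamentalLatticeRep N) x q))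
  have hi2 : ∀ k, Integrable (fun U : GaugeConfig d L (Matrix.specialUnitaryGroup (Fin N) ℂ) =>
      mergeTerm (fundamentalRep (Fin N)) 1 (x.shift μ) ν₀ U (plaqWord ν₀ μ false) x q k)
      (wilsonMeasure (d := d) (L := L) (fundamentalRep (Fin N)) β) :=
    fun k => integrable_of_continuous (fundamentalLatticeRep N) β
      (continuous_mergeTerm (fundamentalLatticeRep N) 1 (x.shift μ) ν₀ _ x q k)
  rw [← integral_finsetSum _ fun k _ => hi1 k, ← integral_finsetSum _ fun k _ => hi2 k] at h
  simp_rw [← Finset.sum_mul, Equipartition.sum_splitTerm_plaqWord (fundamentalRep (Fin N)) hL 1 (x.shift μ) hν₀μ _ false,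
    ← trace_wordHolonomy_plaqWord_rot, sum_mergeTerm_eq_zero_of_avoids 1 (x.shift μ) ν₀ _ (plaqWord ν₀ μ false) x hq,
    integral_zero, add_zero] at h
  have e1 : ∀ U : GaugeConfig d L (Matrix.specialUnitaryGroup (Fin N) ℂ),
      ((N : ℂ) - 1 / N) * (fundamentalRep (Fin N) (wordHolonomy U x (plaqWord μ ν₀ true))).trace *
        (fundamentalRep (Fin N) (wordHolonomy U x q)).trace = ((N : ℂ) - 1 / N) *
        ((fundamentalRep (Fin N) (wordHolonomy U x (plaqWord μ ν₀ true))).trace *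
          (fundamentalRep (Fin N) (wordHolonomy U x q)).trace) := fun U => by ring
  simp_rw [e1] at h
  rw [integral_const_mul] at h
  -- restate on the nose
  have h' : ((N : ℂ) - 1 / N) * (∫ U, (fundamentalRep (Fin N) (wordHolonomy U x (plaqWord μ ν₀ true))).trace *
      (fundamentalRep (Fin N) (wordHolonomy U x q)).trace ∂(wilsonMeasure (d := d) (L := L) (fundamentalRep (Fin N)) β)) +
      (β / 2 : ℂ) * ∑ ν ∈ Finset.univ.erase ν₀, ∑ ε : Bool,
        ∫ U, plaqTerm (fundamentalRep (Fin N)) 1 (x.shift μ) ν₀ U (plaqWord ν₀ μ false) ν ε *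
          (fundamentalRep (Fin N) (wordHolonomy U x q)).trace ∂(wilsonMeasure (d := d) (L := L) (fundamentalRep (Fin N)) β) = 0 := h
  -- norms
  have hR : ‖∑ ν ∈ Finset.univ.erase ν₀, ∑ ε : Bool,
      ∫ U, plaqTerm (fundamentalRep (Fin N)) 1 (x.shift μ) ν₀ U (plaqWord ν₀ μ false) ν ε *
        (fundamentalRep (Fin N) (wordHolonomy U x q)).trace ∂(wilsonMeasure (d := d) (L := L) (fundamentalRep (Fin N)) β)‖ ≤
      ((d : ℝ) - 1) * (2 * (2 * N * (1 + ‖(1 : ℂ)‖) * N)) :=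
    norm_sum_sum_integral_plaqTerm_mul_trace_le (d := d) (L := L) (fundamentalLatticeRep N) β 1 (x.shift μ) ν₀
      (plaqWord ν₀ μ false) x q
  rw [norm_one] at hR
  have hcC : ((N : ℂ) - 1 / N) = ((((N : ℝ) ^ 2 - 1) / N : ℝ) : ℂ) := by
    have hN0 : (N : ℂ) ≠ 0 := by exact_mod_cast hNpos.ne'
    push_cast
    field_simp
  have hβ2 : ‖(β / 2 : ℂ)‖ = |β| / 2 := norm_half_ofReal β
  have key := congrArg (fun z : ℂ => ‖z‖) (eq_neg_of_add_eq_zero_left h')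
  simp only [norm_mul, norm_neg, hcC, Complex.norm_real, Real.norm_eq_abs, hβ2,
    abs_of_pos (div_pos hN21 hNpos)] at key
  -- `((N²−1)/N)·‖D‖ = (|β|/2)‖S‖ ≤ (|β|/2)(d−1)·2·(2N·2·N)`
  have hd1 : (0 : ℝ) ≤ (d : ℝ) - 1 := sub_one_nonneg_of_axis μ
  rw [le_div_iff₀ hN21]
  have hmain := mul_le_mul_of_nonneg_left hR (by positivity : (0 : ℝ) ≤ |β| / 2)
  rw [← key] at hmain
  have := mul_le_mul_of_nonneg_left hmain hNpos.le
  calc _ = (N : ℝ) * (((N : ℝ) ^ 2 - 1) / N * ‖∫ U, (fundamentalRep (Fin N) (wordHolonomy U x (plaqWord μ ν₀ true))).trace *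
        (fundamentalRep (Fin N) (wordHolonomy U x q)).trace ∂(wilsonMeasure (d := d) (L := L) (fundamentalRep (Fin N)) β)‖) := by
        field_simp
    _ ≤ (N : ℝ) * (|β| / 2 * (((d : ℝ) - 1) * (2 * (2 * N * (1 + 1) * N)))) := this
    _ = 4 * ((d : ℝ) - 1) * (N : ℝ) ^ 3 * |β| := by ring

end Avoiding

/-! ## `E|tr U_P|² = 1 + O(β)` and the doubly-wound plaquette -/

section Double

/-- ★ **`E[tr U_P · tr U_P⁻¹] = E|tr U_P|² = 1 + O(β)`, `SU(N)`** (`N ≥ 1`): `‖E[tr hol P̃₀ · tr hol P̃₀⁻¹] − 1‖ ≤ 4(d−1)N|β|`.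
[folklore] -/
theorem norm_integral_trace_mul_trace_reverse_sub_one_suN_le (hN : 1 ≤ N) (hL : (1 : ZMod L) ≠ 0) (β : ℝ) (x : Site d L)
    {μ ν₀ : Fin d} (hμν₀ : μ ≠ ν₀) :
    ‖(∫ U, (fundamentalRep (Fin N) (wordHolonomy U x (plaqWord μ ν₀ true))).trace *
        (fundamentalRep (Fin N) (wordHolonomy U x (plaqWord μ ν₀ true).reverse)).trace
          ∂(wilsonMeasure (d := d) (L := L) (fundamentalRep (Fin N)) β)) - 1‖ ≤ 4 * ((d : ℝ) - 1) * N * |β| := by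
  have hNpos : (0 : ℝ) < N := by exact_mod_cast hN
  have h := spectator_reverse_identity (d := d) (L := L) (fundamentalLatticeRep N) hL β x hμν₀ 1
    fun i j => sdPair₂_specialUnitaryGroup N β x μ x _ x _ _ (trace_unitDir_one i j)
  simp only [fundamentalLatticeRep_N] at h
  have h' : (N : ℂ) * ((∫ U, (fundamentalRep (Fin N) (wordHolonomy U x (plaqWord μ ν₀ true))).trace *
      (fundamentalRep (Fin N) (wordHolonomy U x (plaqWord μ ν₀ true).reverse)).trace
        ∂(wilsonMeasure (d := d) (L := L) (fundamentalRep (Fin N)) β)) - 1) =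
      -((β / 2 : ℂ) * ∑ ν ∈ Finset.univ.erase μ, ∑ ε : Bool,
        ∫ U, plaqTerm (fundamentalRep (Fin N)) 1 x μ U (plaqWord μ ν₀ true) ν ε *
          (fundamentalRep (Fin N) (wordHolonomy U x (plaqWord μ ν₀ true).reverse)).trace
            ∂(wilsonMeasure (d := d) (L := L) (fundamentalRep (Fin N)) β)) := by
    rw [mul_sub, mul_one]; exact h
  have hR : ‖∑ ν ∈ Finset.univ.erase μ, ∑ ε : Bool,
      ∫ U, plaqTerm (fundamentalRep (Fin N)) 1 x μ U (plaqWord μ ν₀ true) ν ε *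
        (fundamentalRep (Fin N) (wordHolonomy U x (plaqWord μ ν₀ true).reverse)).trace
          ∂(wilsonMeasure (d := d) (L := L) (fundamentalRep (Fin N)) β)‖ ≤ ((d : ℝ) - 1) * (2 * (2 * N * (1 + ‖(1 : ℂ)‖) * N)) :=
    norm_sum_sum_integral_plaqTerm_mul_trace_le (d := d) (L := L) (fundamentalLatticeRep N) β 1 x μ
      (plaqWord μ ν₀ true) x (plaqWord μ ν₀ true).reverse
  rw [norm_one] at hR
  have key := congrArg (fun z : ℂ => ‖z‖) h'
  have hβ2 : ‖(β / 2 : ℂ)‖ = |β| / 2 := norm_half_ofReal β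
  simp only [norm_mul, norm_neg, Complex.norm_natCast, hβ2] at key
  have hd1 : (0 : ℝ) ≤ (d : ℝ) - 1 := sub_one_nonneg_of_axis μ
  have hmain := mul_le_mul_of_nonneg_left hR (by positivity : (0 : ℝ) ≤ |β| / 2)
  rw [← key] at hmain
  rw [← mul_le_mul_iff_of_pos_left hNpos]
  refine hmain.trans (le_of_eq ?_)
  ring

/-- ★ **The doubly-wound plaquette, `SU(N)`, `N ≥ 3`**: `‖E[tr ρ(U_P²)]‖ ≤ 8(d−1)|β|·N⁴/((N²−1)(N²−4))`, from the
2×2 system `(N − 2/N)b + a = r₂`, `(N − 2/N)a + b = r₁` (`|r₂| ≤ 4(d−1)N|β|`, `|r₁| ≤ 4(d−1)N²|β|`), non-degenerate for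
`N ≥ 3`. [folklore] -/
theorem norm_integral_trace_double_suN_le (hN : 3 ≤ N) (hL : (1 : ZMod L) ≠ 0) (β : ℝ) (x : Site d L) {μ ν₀ : Fin d}
    (hμν₀ : μ ≠ ν₀) :
    ‖∫ U, (fundamentalRep (Fin N) (wordHolonomy U x (plaqWord μ ν₀ true ++ plaqWord μ ν₀ true))).trace
        ∂(wilsonMeasure (d := d) (L := L) (fundamentalRep (Fin N)) β)‖ ≤
      8 * ((d : ℝ) - 1) * |β| * ((N : ℝ) ^ 4 / (((N : ℝ) ^ 2 - 1) * ((N : ℝ) ^ 2 - 4))) := by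
  have hN3 : (3 : ℝ) ≤ N := by exact_mod_cast hN
  have hNpos : (0 : ℝ) < N := by linarith
  have hIa := doublyWound_identity (d := d) (L := L) (fundamentalLatticeRep N) hL β x hμν₀ 1
    fun i j => sdPair_specialUnitaryGroup N β x μ x _ _ (trace_unitDir_one i j)
  have hIb := spectator_self_identity (d := d) (L := L) (fundamentalLatticeRep N) hL β x hμν₀ 1
    fun i j => sdPair₂_specialUnitaryGroup N β x μ x _ x _ _ (trace_unitDir_one i j)
  have hR2 := norm_sum_sum_integral_plaqTerm_le (d := d) (L := L) (fundamentalLatticeRep N) β 1 x μ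
    (plaqWord μ ν₀ true ++ plaqWord μ ν₀ true)
  have hR1 := norm_sum_sum_integral_plaqTerm_mul_trace_le (d := d) (L := L) (fundamentalLatticeRep N) β 1 x μ
    (plaqWord μ ν₀ true) x (plaqWord μ ν₀ true)
  rw [show ((fundamentalLatticeRep N).N : ℂ) = N from rfl, mul_one] at hIa hIb
  rw [norm_one, show ((fundamentalLatticeRep N).N : ℝ) = N from rfl] at hR2 hR1
  -- `m = N − 2/N`; `b (m² − 1) = m r₂ − r₁`
  set m : ℝ := (N : ℝ) - 2 / N with hm
  have hmC : ((N : ℂ) - 2 / N) = (m : ℂ) := by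
    simp only [hm, Complex.ofReal_sub, Complex.ofReal_div, Complex.ofReal_natCast, Complex.ofReal_ofNat]
  rw [hmC] at hIa hIb
  have key := congrArg (fun z : ℂ => ‖z‖) (show _ = _ from by linear_combination (m : ℂ) * hIa - hIb :
    (∫ U, ((fundamentalLatticeRep N).ρ (wordHolonomy U x (plaqWord μ ν₀ true ++ plaqWord μ ν₀ true))).trace
        ∂(wilsonMeasure (d := d) (L := L) (fundamentalLatticeRep N).ρ β)) * ((m : ℂ) ^ 2 - 1) =
      (β / 2 : ℂ) * (∑ ν ∈ Finset.univ.erase μ, ∑ ε : Bool,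
        ∫ U, plaqTerm (fundamentalLatticeRep N).ρ 1 x μ U (plaqWord μ ν₀ true) ν ε *
          ((fundamentalLatticeRep N).ρ (wordHolonomy U x (plaqWord μ ν₀ true))).trace
          ∂(wilsonMeasure (d := d) (L := L) (fundamentalLatticeRep N).ρ β)) -
      (m : ℂ) * ((β / 2 : ℂ) * ∑ ν ∈ Finset.univ.erase μ, ∑ ε : Bool,
        ∫ U, plaqTerm (fundamentalLatticeRep N).ρ 1 x μ U (plaqWord μ ν₀ true ++ plaqWord μ ν₀ true) ν ε
          ∂(wilsonMeasure (d := d) (L := L) (fundamentalLatticeRep N).ρ β)))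
  have hm1 : 1 < m := by
    rw [hm, lt_sub_iff_add_lt]
    have : 2 / (N : ℝ) ≤ 2 / 3 := div_le_div_of_nonneg_left (by norm_num) (by norm_num) hN3
    linarith
  have hm0 : 0 < m := by linarith
  have hmN : m ≤ N := by
    have h2N : (0 : ℝ) ≤ 2 / N := by positivity
    rw [hm]; linarith
  have hm21 : 0 < m ^ 2 - 1 := by nlinarith
  have hβ2 : ‖(β / 2 : ℂ)‖ = |β| / 2 := norm_half_ofReal β
  have hm2C : ‖((m : ℂ) ^ 2 - 1)‖ = m ^ 2 - 1 := by
    rw [show ((m : ℂ) ^ 2 - 1) = ((m ^ 2 - 1 : ℝ) : ℂ) by push_cast; ring, Complex.norm_real, Real.norm_eq_abs,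
      abs_of_pos hm21]
  simp only [norm_mul, hm2C] at key
  have hd1 : (0 : ℝ) ≤ (d : ℝ) - 1 := sub_one_nonneg_of_axis μ
  -- `‖b‖ (m²−1) ≤ (|β|/2)(R1 + m R2) ≤ 8(d−1)N²|β|`
  have hb : ‖∫ U, ((fundamentalLatticeRep N).ρ (wordHolonomy U x (plaqWord μ ν₀ true ++ plaqWord μ ν₀ true))).trace
      ∂(wilsonMeasure (d := d) (L := L) (fundamentalLatticeRep N).ρ β)‖ * (m ^ 2 - 1) ≤ 8 * ((d : ℝ) - 1) * (N : ℝ) ^ 2 * |β| := by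
    rw [key]
    refine (norm_sub_le _ _).trans ?_
    rw [norm_mul, norm_mul, norm_mul, hβ2, Complex.norm_real, Real.norm_eq_abs, abs_of_pos hm0]
    have h1 := mul_le_mul_of_nonneg_left hR1 (by positivity : (0 : ℝ) ≤ |β| / 2)
    have h2 := mul_le_mul_of_nonneg_left (mul_le_mul_of_nonneg_left hR2 (by positivity : (0 : ℝ) ≤ |β| / 2)) hm0.le
    have h3 : m * (|β| / 2 * (((d : ℝ) - 1) * (2 * (2 * N * (1 + 1))))) ≤ N * (|β| / 2 * (((d : ℝ) - 1) * (2 * (2 * N * (1 + 1))))) :=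
      mul_le_mul_of_nonneg_right hmN (by positivity)
    nlinarith [h1, h2, h3]
  -- `m² − 1 = (N²−1)(N²−4)/N²`
  have hmsq : m ^ 2 - 1 = ((N : ℝ) ^ 2 - 1) * ((N : ℝ) ^ 2 - 4) / (N : ℝ) ^ 2 := by
    rw [hm]; field_simp; ring
  have hK : 0 < ((N : ℝ) ^ 2 - 1) * ((N : ℝ) ^ 2 - 4) := by
    have h9 : (9 : ℝ) ≤ (N : ℝ) ^ 2 := by nlinarith
    exact mul_pos (by linarith) (by linarith)
  rw [hmsq] at hb
  have := (le_div_iff₀ (by positivity : (0 : ℝ) < ((N : ℝ) ^ 2 - 1) * ((N : ℝ) ^ 2 - 4) / (N : ℝ) ^ 2)).2 hb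
  refine this.trans (le_of_eq ?_)
  field_simp

/-- ★ **The squared trace, `SU(N)`, `N ≥ 3`**: `‖E[(tr U_P)²]‖ ≤ 8(d−1)|β|·N⁵/((N²−1)(N²−4))` (same system, solved for `a`).
[folklore] -/
theorem norm_integral_trace_sq_suN_le (hN : 3 ≤ N) (hL : (1 : ZMod L) ≠ 0) (β : ℝ) (x : Site d L) {μ ν₀ : Fin d}
    (hμν₀ : μ ≠ ν₀) :
    ‖∫ U, (fundamentalRep (Fin N) (wordHolonomy U x (plaqWord μ ν₀ true))).trace *
        (fundamentalRep (Fin N) (wordHolonomy U x (plaqWord μ ν₀ true))).trace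
          ∂(wilsonMeasure (d := d) (L := L) (fundamentalRep (Fin N)) β)‖ ≤
      8 * ((d : ℝ) - 1) * |β| * ((N : ℝ) ^ 5 / (((N : ℝ) ^ 2 - 1) * ((N : ℝ) ^ 2 - 4))) := by
  have hN3 : (3 : ℝ) ≤ N := by exact_mod_cast hN
  have hNpos : (0 : ℝ) < N := by linarith
  have hN1 : (1 : ℝ) ≤ N := by linarith
  have hIa := doublyWound_identity (d := d) (L := L) (fundamentalLatticeRep N) hL β x hμν₀ 1
    fun i j => sdPair_specialUnitaryGroup N β x μ x _ _ (trace_unitDir_one i j)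
  have hIb := spectator_self_identity (d := d) (L := L) (fundamentalLatticeRep N) hL β x hμν₀ 1
    fun i j => sdPair₂_specialUnitaryGroup N β x μ x _ x _ _ (trace_unitDir_one i j)
  have hR2 := norm_sum_sum_integral_plaqTerm_le (d := d) (L := L) (fundamentalLatticeRep N) β 1 x μ
    (plaqWord μ ν₀ true ++ plaqWord μ ν₀ true)
  have hR1 := norm_sum_sum_integral_plaqTerm_mul_trace_le (d := d) (L := L) (fundamentalLatticeRep N) β 1 x μ
    (plaqWord μ ν₀ true) x (plaqWord μ ν₀ true)
  rw [show ((fundamentalLatticeRep N).N : ℂ) = N from rfl, mul_one] at hIa hIb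
  rw [norm_one, show ((fundamentalLatticeRep N).N : ℝ) = N from rfl] at hR2 hR1
  set m : ℝ := (N : ℝ) - 2 / N with hm
  have hmC : ((N : ℂ) - 2 / N) = (m : ℂ) := by
    simp only [hm, Complex.ofReal_sub, Complex.ofReal_div, Complex.ofReal_natCast, Complex.ofReal_ofNat]
  rw [hmC] at hIa hIb
  have key := congrArg (fun z : ℂ => ‖z‖) (show _ = _ from by linear_combination (m : ℂ) * hIb - hIa :
    (∫ U, ((fundamentalLatticeRep N).ρ (wordHolonomy U x (plaqWord μ ν₀ true))).trace *
        ((fundamentalLatticeRep N).ρ (wordHolonomy U x (plaqWord μ ν₀ true))).trace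
        ∂(wilsonMeasure (d := d) (L := L) (fundamentalLatticeRep N).ρ β)) * ((m : ℂ) ^ 2 - 1) =
      (β / 2 : ℂ) * (∑ ν ∈ Finset.univ.erase μ, ∑ ε : Bool,
        ∫ U, plaqTerm (fundamentalLatticeRep N).ρ 1 x μ U (plaqWord μ ν₀ true ++ plaqWord μ ν₀ true) ν ε
          ∂(wilsonMeasure (d := d) (L := L) (fundamentalLatticeRep N).ρ β)) -
      (m : ℂ) * ((β / 2 : ℂ) * ∑ ν ∈ Finset.univ.erase μ, ∑ ε : Bool,
        ∫ U, plaqTerm (fundamentalLatticeRep N).ρ 1 x μ U (plaqWord μ ν₀ true) ν ε *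
          ((fundamentalLatticeRep N).ρ (wordHolonomy U x (plaqWord μ ν₀ true))).trace
          ∂(wilsonMeasure (d := d) (L := L) (fundamentalLatticeRep N).ρ β)))
  have hm1 : 1 < m := by
    rw [hm, lt_sub_iff_add_lt]
    have : 2 / (N : ℝ) ≤ 2 / 3 := div_le_div_of_nonneg_left (by norm_num) (by norm_num) hN3
    linarith
  have hm0 : 0 < m := by linarith
  have hmN : m ≤ N := by
    have h2N : (0 : ℝ) ≤ 2 / N := by positivity
    rw [hm]; linarith
  have hm21 : 0 < m ^ 2 - 1 := by nlinarith
  have hβ2 : ‖(β / 2 : ℂ)‖ = |β| / 2 := norm_half_ofReal β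
  have hm2C : ‖((m : ℂ) ^ 2 - 1)‖ = m ^ 2 - 1 := by
    rw [show ((m : ℂ) ^ 2 - 1) = ((m ^ 2 - 1 : ℝ) : ℂ) by push_cast; ring, Complex.norm_real, Real.norm_eq_abs,
      abs_of_pos hm21]
  simp only [norm_mul, hm2C] at key
  have hd1 : (0 : ℝ) ≤ (d : ℝ) - 1 := sub_one_nonneg_of_axis μ
  have ha : ‖∫ U, ((fundamentalLatticeRep N).ρ (wordHolonomy U x (plaqWord μ ν₀ true))).trace *
      ((fundamentalLatticeRep N).ρ (wordHolonomy U x (plaqWord μ ν₀ true))).trace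
      ∂(wilsonMeasure (d := d) (L := L) (fundamentalLatticeRep N).ρ β)‖ * (m ^ 2 - 1) ≤ 8 * ((d : ℝ) - 1) * (N : ℝ) ^ 3 * |β| := by
    rw [key]
    refine (norm_sub_le _ _).trans ?_
    rw [norm_mul, norm_mul, norm_mul, hβ2, Complex.norm_real, Real.norm_eq_abs, abs_of_pos hm0]
    have h1 := mul_le_mul_of_nonneg_left hR2 (by positivity : (0 : ℝ) ≤ |β| / 2)
    have h2 := mul_le_mul_of_nonneg_left (mul_le_mul_of_nonneg_left hR1 (by positivity : (0 : ℝ) ≤ |β| / 2)) hm0.le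
    have h3 : m * (|β| / 2 * (((d : ℝ) - 1) * (2 * (2 * N * (1 + 1) * N)))) ≤
        N * (|β| / 2 * (((d : ℝ) - 1) * (2 * (2 * N * (1 + 1) * N)))) := mul_le_mul_of_nonneg_right hmN (by positivity)
    have h4 : |β| / 2 * (((d : ℝ) - 1) * (2 * (2 * N * (1 + 1)))) ≤ |β| / 2 * (((d : ℝ) - 1) * (2 * (2 * N * (1 + 1)))) * N ^ 2 := by
      have hN2 : (1 : ℝ) ≤ (N : ℝ) ^ 2 := by nlinarith
      have h0 : (0 : ℝ) ≤ |β| / 2 * (((d : ℝ) - 1) * (2 * (2 * N * (1 + 1)))) := by positivity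
      nlinarith
    nlinarith [h1, h2, h3, h4]
  have hmsq : m ^ 2 - 1 = ((N : ℝ) ^ 2 - 1) * ((N : ℝ) ^ 2 - 4) / (N : ℝ) ^ 2 := by
    rw [hm]; field_simp; ring
  have hK : 0 < ((N : ℝ) ^ 2 - 1) * ((N : ℝ) ^ 2 - 4) := by
    have h9 : (9 : ℝ) ≤ (N : ℝ) ^ 2 := by nlinarith
    exact mul_pos (by linarith) (by linarith)
  rw [hmsq] at ha
  have := (le_div_iff₀ (by positivity : (0 : ℝ) < ((N : ℝ) ^ 2 - 1) * ((N : ℝ) ^ 2 - 4) / (N : ℝ) ^ 2)).2 ha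
  refine this.trans (le_of_eq ?_)
  field_simp

/-! ### `SU(2)`: `tr U² = (tr U)² − 2` -/

/-- **`SU(2)`: the doubly-wound plaquette in terms of the squared trace**: `E[tr hol(P̃₀P̃₀)] = E[(tr hol P̃₀)²] − 2`
(Cayley–Hamilton on `SU(2)`, tree `trace_mul_trace_su_two`). [folklore] -/
theorem integral_trace_double_su_two (β : ℝ) (x : Site d L) (μ ν₀ : Fin d) :
    ∫ U, (fundamentalRep (Fin 2) (wordHolonomy U x (plaqWord μ ν₀ true ++ plaqWord μ ν₀ true))).trace
        ∂(wilsonMeasure (d := d) (L := L) (fundamentalRep (Fin 2)) β) =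
      (∫ U, (fundamentalRep (Fin 2) (wordHolonomy U x (plaqWord μ ν₀ true))).trace *
        (fundamentalRep (Fin 2) (wordHolonomy U x (plaqWord μ ν₀ true))).trace
          ∂(wilsonMeasure (d := d) (L := L) (fundamentalRep (Fin 2)) β)) - 2 := by
  haveI := isProbabilityMeasure_wilsonMeasure (d := d) (L := L) (fundamentalRep (Fin 2))
    (fundamentalLatticeRep 2).continuous β
  have hpt : ∀ U : GaugeConfig d L (Matrix.specialUnitaryGroup (Fin 2) ℂ),
      (fundamentalRep (Fin 2) (wordHolonomy U x (plaqWord μ ν₀ true ++ plaqWord μ ν₀ true))).trace =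
        (fundamentalRep (Fin 2) (wordHolonomy U x (plaqWord μ ν₀ true))).trace *
          (fundamentalRep (Fin 2) (wordHolonomy U x (plaqWord μ ν₀ true))).trace - 2 := fun U => by
    rw [trace_mul_trace_su_two, mul_inv_cancel, map_one, Matrix.trace_one, Fintype.card_fin, wordHolonomy_append,
      endpoint_plaqWord]
    push_cast; ring
  simp_rw [hpt]
  have hi : Integrable (fun U : GaugeConfig d L (Matrix.specialUnitaryGroup (Fin 2) ℂ) =>
      (fundamentalRep (Fin 2) (wordHolonomy U x (plaqWord μ ν₀ true))).trace *
        (fundamentalRep (Fin 2) (wordHolonomy U x (plaqWord μ ν₀ true))).trace)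
      (wilsonMeasure (d := d) (L := L) (fundamentalRep (Fin 2)) β) :=
    integrable_trace_mul_trace_latticeRep (d := d) (L := L) (fundamentalLatticeRep 2) β x x _ _
  rw [integral_sub hi (integrable_const _), integral_const, probReal_univ, one_smul]

omit [NeZero L] in
/-- **`SU(2)`: `tr hol(P̃₀⁻¹) = tr hol(P̃₀)`** (real traces). [folklore] -/
theorem trace_wordHolonomy_plaqWord_reverse_su_two (U : GaugeConfig d L (Matrix.specialUnitaryGroup (Fin 2) ℂ))
    (x : Site d L) (μ ν₀ : Fin d) :
    (fundamentalRep (Fin 2) (wordHolonomy U x (plaqWord μ ν₀ true).reverse)).trace =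
      (fundamentalRep (Fin 2) (wordHolonomy U x (plaqWord μ ν₀ true))).trace := by
  have h := wordHolonomy_reverse U x (plaqWord μ ν₀ true)
  rw [endpoint_plaqWord] at h
  rw [h, trace_fundamentalRep_two_inv]

/-- ★ **`SU(2)`: `E[(tr U_P)²] = 1 + O(β)`**: `‖E[(tr hol P̃₀)²] − 1‖ ≤ 8(d−1)|β|`. [folklore] -/
theorem norm_integral_trace_sq_sub_one_su_two_le (hL : (1 : ZMod L) ≠ 0) (β : ℝ) (x : Site d L) {μ ν₀ : Fin d}
    (hμν₀ : μ ≠ ν₀) :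
    ‖(∫ U, (fundamentalRep (Fin 2) (wordHolonomy U x (plaqWord μ ν₀ true))).trace *
        (fundamentalRep (Fin 2) (wordHolonomy U x (plaqWord μ ν₀ true))).trace
          ∂(wilsonMeasure (d := d) (L := L) (fundamentalRep (Fin 2)) β)) - 1‖ ≤ 8 * ((d : ℝ) - 1) * |β| := by
  have h := norm_integral_trace_mul_trace_reverse_sub_one_suN_le (d := d) (L := L) (N := 2) (by norm_num) hL β x hμν₀
  simp_rw [trace_wordHolonomy_plaqWord_reverse_su_two] at h
  refine h.trans (le_of_eq ?_)
  push_cast; ring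

end Double

end StrongCoupling

end Summit.QuantumFields.GaugeBoot

end
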